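import Literature.AnabelianGeometry.AbsoluteAnabelian.ProfiniteRankProofs
import Literature.AnabelianGeometry.AbsoluteAnabelian.AbsTopIProp23InfiniteIndexProofs
import Literature.AnabelianGeometry.AbsoluteAnabelian.GaloisSubextensionProofs
import HarnessLib

/-!
# Topological finite generation ASCENDS from an open subgroup of a compact group ([AbsTopI] §0)

S. Mochizuki, *Topics in Absolute Anabelian Geometry I: Generalities* (2012) [AbsTopI] (lit key
`paper:url-11ac98ba15fc`), §0 p. 8 ("topologically finitely generated") and Prop 2.2 p. 18 ("Any profinite group
`Δ` of GFG-type is topologically finitely generated").  The tree has the DESCENT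
(`IsTopologicallyFinitelyGenerated.subgroup_isOpen`: open subgroups of compact t.f.g. groups are t.f.g.) and
extensions (`IsTopologicallyFinitelyGenerated.of_extension`).  This PROOF-ONLY file (no definition, no named fact)
adds the ASCENT:

* `IsTopologicallyFinitelyGenerated.of_isOpen_subgroup` — **a compact Hausdorff group with a topologically finitely
  generated OPEN subgroup is topologically finitely generated** (pass to the open normal core `W ⊆ U`, t.f.g. as an
  open subgroup of the compact t.f.g. `U`; the quotient `G/W` is finite discrete, hence t.f.g.; conclude by
  `of_extension` along `G ↠ G/W`).

USE: [AbsTopI] Prop 2.2 / 2.3 (ii) at the ALMOST pro-`Σ` surface-group model (node AbsTopI:Prop2.3(ii)): the almost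
pro-`Σ` `Δ_X` of Def 2.1 (i) contains the pro-`Σ` completion of a surface group as an OPEN subgroup, which is
t.f.g. (`geomTFG_of_isProSigmaCompletion_puncturedSurfaceGroup`), so `Δ_X` is t.f.g.  Classical; OUR kernel check;
nothing here bears on [IUTchIII] Cor. 3.12.
-/

noncomputable section

open Topology

universe u

namespace Literature.AnabelianGeometry.AbsoluteAnabelian

variable {G : Type u} [Group G] [TopologicalSpace G] [IsTopologicalGroup G]

/-- In a compact group, the normal core of an open subgroup is open (private copy; cf. `isOpen_normalCore` for
`OpenSubgroup`s in `GaloisCyclotomeMLFReduction.lean`). [cite: MochizukiAbsTopI2012, §0 p.8] -/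
private theorem isOpen_normalCore_aux' [CompactSpace G] (H : Subgroup G) (hH : IsOpen (H : Set G)) :
    IsOpen (H.normalCore : Set G) := by
  haveI : Finite (G ⧸ H) := Subgroup.quotient_finite_of_isOpen H hH
  haveI : H.FiniteIndex := Subgroup.finiteIndex_of_finite_quotient
  haveI : H.normalCore.FiniteIndex := Subgroup.finiteIndex_normalCore H
  exact Subgroup.isOpen_of_isClosed_of_finiteIndex _
    (H.normalCore_isClosed (Subgroup.isClosed_of_isOpen H hH))

/-- A subgroup `W ⊆ U`, open in `G`, is t.f.g. (as a subgroup of `G`) when `U` is compact and t.f.g.: `W ∩ U = W` is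
open in `U`, t.f.g. there by the descent lemma, and the tautological map onto `W` is a continuous surjection.
[cite: MochizukiAbsTopI2012, §0 p.8] -/
theorem IsTopologicallyFinitelyGenerated.of_le_of_isOpen [CompactSpace G] {U W : Subgroup G}
    (hU : IsTopologicallyFinitelyGenerated U) (hUc : IsClosed (U : Set G)) (hWU : W ≤ U)
    (hWo : IsOpen (W : Set G)) : IsTopologicallyFinitelyGenerated W := by
  haveI : CompactSpace U := isCompact_iff_compactSpace.mp hUc.isCompact
  have hWUo : IsOpen ((W.subgroupOf U : Subgroup U) : Set U) := by
    rw [Subgroup.coe_subgroupOf]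
    exact hWo.preimage continuous_subtype_val
  have hW' := hU.subgroup_isOpen _ hWUo
  have hmem : ∀ x : W.subgroupOf U, ((x : U) : G) ∈ W := fun x => by
    have hx := x.2
    rw [Subgroup.mem_subgroupOf] at hx
    exact hx
  let f : (W.subgroupOf U) →ₜ* W :=
    { toFun := fun x => ⟨((x : U) : G), hmem x⟩
      map_one' := Subtype.ext rfl
      map_mul' := fun _ _ => Subtype.ext rfl
      continuous_toFun := (continuous_subtype_val.comp continuous_subtype_val).subtype_mk _ }
  have hf : Function.Surjective f := by
    rintro ⟨w, hw⟩
    exact ⟨⟨⟨w, hWU hw⟩, by rw [Subgroup.mem_subgroupOf]; exact hw⟩, rfl⟩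
  exact IsTopologicallyFinitelyGenerated.of_surjective f hf hW'

/-- **Topological finite generation ascends from an open subgroup of a compact Hausdorff group.**
[cite: MochizukiAbsTopI2012, §0 p.8] -/
theorem IsTopologicallyFinitelyGenerated.of_isOpen_subgroup [CompactSpace G] [T2Space G] (U : Subgroup G)
    (hUo : IsOpen (U : Set G)) (hU : IsTopologicallyFinitelyGenerated U) : IsTopologicallyFinitelyGenerated G := by
  -- the open normal core `W ⊆ U`
  let W : Subgroup G := U.normalCore
  haveI : W.Normal := Subgroup.normalCore_normal U
  have hWo : IsOpen (W : Set G) := isOpen_normalCore_aux' U hUo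
  haveI hWc : IsClosed (W : Set G) := Subgroup.isClosed_of_isOpen W hWo
  have hWfg : IsTopologicallyFinitelyGenerated W :=
    hU.of_le_of_isOpen (Subgroup.isClosed_of_isOpen U hUo) (Subgroup.normalCore_le U) hWo
  -- the quotient `G/W` is finite discrete, hence t.f.g.
  haveI : Finite (G ⧸ W) := Subgroup.quotient_finite_of_isOpen W hWo
  haveI : DiscreteTopology (G ⧸ W) := QuotientGroup.discreteTopology hWo
  have hQ : IsTopologicallyFinitelyGenerated (G ⧸ W) := FundamentalExtension.isTopologicallyFinitelyGenerated_of_finite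
  -- extension
  let f : G →ₜ* G ⧸ W := ⟨QuotientGroup.mk' W, QuotientGroup.continuous_mk⟩
  have hker : IsTopologicallyFinitelyGenerated f.toMonoidHom.ker := by
    have h : f.toMonoidHom.ker = W := QuotientGroup.ker_mk' W
    rw [h]
    exact hWfg
  exact IsTopologicallyFinitelyGenerated.of_extension f (QuotientGroup.mk'_surjective W) hker hQ

namespace FundamentalExtension

/-- For the node predicate of [AbsTopI] Prop 2.2: if `Δ = E.geom` has a t.f.g. OPEN subgroup (e.g. a pro-`Σ`
surface-group completion inside an almost pro-`Σ` GFG-type group), then `E.GeomTFG`.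
[cite: MochizukiAbsTopI2012, Prop 2.2 p.18] -/
theorem geomTFG_of_isOpen_subgroup (E : FundamentalExtension.{u}) (U : Subgroup E.geom)
    (hUo : IsOpen (U : Set E.geom)) (hU : IsTopologicallyFinitelyGenerated U) : E.GeomTFG := by
  haveI : CompactSpace E.geom := isCompact_iff_compactSpace.mp E.isClosed_geom.isCompact
  exact IsTopologicallyFinitelyGenerated.of_isOpen_subgroup U hUo hU

end FundamentalExtension

end Literature.AnabelianGeometry.AbsoluteAnabelian

end
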